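import Mathlib
import HarnessLib
import Summits.MatrixMultiplication.MatrixMultiplication.Theorems.FarEdgeDescentFloorDial
import Summits.MatrixMultiplication.MatrixMultiplication.Theorems.FarEdgeDescentNarrownessPotential
import Summits.MatrixMultiplication.MatrixMultiplication.Theorems.FarEdgeDescentFloorNarrowness
import Summits.MatrixMultiplication.MatrixMultiplication.Theorems.FarEdgeDescentNeutralMargin
import Summits.MatrixMultiplication.MatrixMultiplication.Theorems.FarEdgeDescentChainCapSteps

/-!
# Far-edge descent, kernel XLII-F — the certification interface for the region criterion (model level)

Kernels XLII-C/D reduce the trees cap XL-D for a dial `(a, β)` to `RegionCriterion β z ε (Vfloor a β z m) κ_S`,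
and XLII-E treats its neutral strip analytically.  THIS FILE fixes the exact finite targets and the cell tools a
certification (memo g62 §5, g63) works against — so that it consists of rational arithmetic only:

* `regionCriterion_anti`: the criterion is antitone in the floor level (`Vmin' ≤ Vmin`); with
  `capXLD_of_regionCriterion_le` any rational `Vmin' ≤ Vfloor a β z m` may replace `Vfloor`;
* `Vfloor_eight_fifths`, `Vfloor_nineteen_tenths`: `1978/10000 ≤ Vfloor 2 (8/5) (99/100) 12` and
  `483/10000 ≤ Vfloor 2 (19/10) (99/100) 12` (`norm_num` evaluations of the truncated Abel floor minimum);
* `capXLD_eight_fifths_of_criterion`, `capXLD_nineteen_tenths_of_criterion`: **the XL-D text for the dials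
  `(2, 8/5)` and `(2, 19/10)` follows from the single closed rational-parameter statement
  `RegionCriterion (8/5) (99/100) (1/100) (1978/10000) κ_S`** (resp. `(19/10) … (483/10000)`) — the g63 targets;
* cell tools with CERTIFIED HEIGHTS in place of real powers: `tangent_height`
  (`x^κ ≤ (1−κ)ρ + κ(ρ/x₀)·x` from `x₀^κ ≤ ρ`), `lin_cell` (a linear function below `R` at both ends of a cell is
  below `R` on the cell), `cell_bound` (the pair inequality on an `x`-cell from its two endpoint inequalities with
  tangent majorants at menu points `x₀, s₀`), and `strip_bound_height` / `criterion_pair_of_strip_height` (XLII-E's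
  strip lemma with a rational height `σ ≥ s₀^κ`: hypotheses `B·σ ≤ A·s₀`, `(1−κ)·B·σ ≤ λ'·c`).
Numerically (memo g62 §2.3–2.4) both targets hold with margin ≥ 5e-3 off the strip; nothing here proves them.
MODEL level; no `sorry`, no new axioms, no new definitions.
-/

noncomputable section

set_option linter.dupNamespace false

namespace Summit.MatrixMultiplication.MatrixMultiplication.Theorems.FarEdgeDescentCriterionCells

open Real Finset
open Summit.MatrixMultiplication.MatrixMultiplication.Theorems.FarEdgeDescentFloorDial
open Summit.MatrixMultiplication.MatrixMultiplication.Theorems.FarEdgeDescentFloorDial.Sched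
open Summit.MatrixMultiplication.MatrixMultiplication.Theorems.FarEdgeDescentNarrownessPotential
open Summit.MatrixMultiplication.MatrixMultiplication.Theorems.FarEdgeDescentFloorNarrowness
open Summit.MatrixMultiplication.MatrixMultiplication.Theorems.FarEdgeDescentNeutralMargin
open Summit.MatrixMultiplication.MatrixMultiplication.Theorems.FarEdgeDescentChainCapSteps

/-! ## Antitonicity in the floor level and the rational interface -/

/-- The region criterion is antitone in the floor level: a lower floor is a stronger demand. -/
theorem regionCriterion_anti {β z ε Vmin Vmin' κ : ℝ} (h : Vmin' ≤ Vmin)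
    (hc : RegionCriterion β z ε Vmin' κ) : RegionCriterion β z ε Vmin κ := by
  intro lam lam' V V' VP hl hl1 hl' hl'1 hV hV1 hV' hV'1 hW hW' hQ hQ' hP hVP x hx0 hx1
  exact hc lam lam' V V' VP hl hl1 hl' hl'1 (le_trans h hV) hV1 (le_trans h hV') hV'1 hW hW' hQ hQ' hP
    (le_trans h hVP) x hx0 hx1

/-- **XL-D for a dial from the criterion at any level below the truncated floor minimum.** -/
theorem capXLD_of_regionCriterion_le {a β z ε Vmin' : ℝ} (m : ℕ) (ha : 2 ≤ a) (hβ : 3 / 2 ≤ β)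
    (hβ2 : β ≤ 2) (hz : 9 / 10 ≤ z) (hz1 : z ≤ 1) (hε : 0 < ε) (hle : Vmin' ≤ Vfloor a β z m)
    (hcrit : RegionCriterion β z ε Vmin' (Real.log (4 / 3) / Real.log 2)) :
    ∀ R : ℝ, 0 ≤ R → ∀ y₀ : ℝ → ℝ, (∀ b : ℝ, 0 ≤ b → 0 ≤ y₀ b ∧ y₀ b ≤ R / (b + β)) →
      ∃ C : ℝ, ∀ s : Sched, Admissible a β s →
        dev β y₀ s ≤ C * logSize β s ^ (Real.log (4 / 3) / Real.log 2) :=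
  capXLD_of_regionCriterion_floor m ha hβ hβ2 hz hz1 hε (regionCriterion_anti hle hcrit)

/-! ## The two finite targets -/

set_option maxHeartbeats 400000 in
/-- `Vfloor 2 (8/5) (99/100) 12 ≥ 0.1978` (its value is `0.197812…`; the exact floor minimum is `0.197833…`). -/
theorem Vfloor_eight_fifths : (1978 / 10000 : ℝ) ≤ Vfloor 2 (8 / 5) (99 / 100) 12 := by
  norm_num [Vfloor, tauP, sum_range_succ]

set_option maxHeartbeats 400000 in
/-- `Vfloor 2 (19/10) (99/100) 12 ≥ 0.0483` (its value is `0.048391…`; the exact floor minimum is `0.048416…`). -/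
theorem Vfloor_nineteen_tenths : (483 / 10000 : ℝ) ≤ Vfloor 2 (19 / 10) (99 / 100) 12 := by
  norm_num [Vfloor, tauP, sum_range_succ]

/-- **Target β = 8/5.**  The closed statement `RegionCriterion (8/5) (99/100) (1/100) (1978/10000) κ_S`
implies the XL-D cap for the dial `(2, 8/5)`, all admissible schedules, all bases. -/
theorem capXLD_eight_fifths_of_criterion
    (hcrit : RegionCriterion (8 / 5) (99 / 100) (1 / 100) (1978 / 10000) (Real.log (4 / 3) / Real.log 2)) :
    ∀ R : ℝ, 0 ≤ R → ∀ y₀ : ℝ → ℝ, (∀ b : ℝ, 0 ≤ b → 0 ≤ y₀ b ∧ y₀ b ≤ R / (b + 8 / 5)) →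
      ∃ C : ℝ, ∀ s : Sched, Admissible 2 (8 / 5) s →
        dev (8 / 5) y₀ s ≤ C * logSize (8 / 5) s ^ (Real.log (4 / 3) / Real.log 2) :=
  capXLD_of_regionCriterion_le 12 le_rfl (by norm_num) (by norm_num) (by norm_num) (by norm_num)
    (by norm_num) Vfloor_eight_fifths hcrit

/-- **Target β = 19/10.**  The closed statement `RegionCriterion (19/10) (99/100) (1/100) (483/10000) κ_S`
implies the XL-D cap for the dial `(2, 19/10)`, all admissible schedules, all bases. -/
theorem capXLD_nineteen_tenths_of_criterion
    (hcrit : RegionCriterion (19 / 10) (99 / 100) (1 / 100) (483 / 10000)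
      (Real.log (4 / 3) / Real.log 2)) :
    ∀ R : ℝ, 0 ≤ R → ∀ y₀ : ℝ → ℝ, (∀ b : ℝ, 0 ≤ b → 0 ≤ y₀ b ∧ y₀ b ≤ R / (b + 19 / 10)) →
      ∃ C : ℝ, ∀ s : Sched, Admissible 2 (19 / 10) s →
        dev (19 / 10) y₀ s ≤ C * logSize (19 / 10) s ^ (Real.log (4 / 3) / Real.log 2) :=
  capXLD_of_regionCriterion_le 12 le_rfl (by norm_num) (by norm_num) (by norm_num) (by norm_num)
    (by norm_num) Vfloor_nineteen_tenths hcrit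

/-! ## Cell tools with certified heights -/

/-- Tangent majorant with a certified height: `x₀^κ ≤ ρ` gives `x^κ ≤ (1−κ)ρ + κ(ρ/x₀)x` on `x ≥ 0`. -/
theorem tangent_height {x x₀ κ ρ : ℝ} (hx : 0 ≤ x) (hx0 : 0 < x₀) (hκ0 : 0 ≤ κ) (hκ1 : κ ≤ 1)
    (hρ : x₀ ^ κ ≤ ρ) : x ^ κ ≤ (1 - κ) * ρ + κ * (ρ / x₀) * x := by
  have h := rpow_tangent hx hx0 hκ0 hκ1 (s := x) (κ := κ)
  have e : x₀ ^ (κ - 1) = x₀ ^ κ / x₀ := rpow_sub_one hx0.ne' κ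
  rw [e] at h
  have h1 : (1 - κ) * x₀ ^ κ ≤ (1 - κ) * ρ := mul_le_mul_of_nonneg_left hρ (by linarith)
  have h2 : κ * (x₀ ^ κ / x₀) * x ≤ κ * (ρ / x₀) * x := by
    apply mul_le_mul_of_nonneg_right _ hx
    exact mul_le_mul_of_nonneg_left (div_le_div_of_nonneg_right hρ hx0.le) hκ0
  linarith

/-- A linear function below `R` at both ends of `[x₁, x₂]` is below `R` on the cell. -/
theorem lin_cell {p q R x₁ x₂ x : ℝ} (h1 : p + q * x₁ ≤ R) (h2 : p + q * x₂ ≤ R) (hx1 : x₁ ≤ x)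
    (hx2 : x ≤ x₂) : p + q * x ≤ R := by
  rcases le_total 0 q with hq | hq
  · have : q * x ≤ q * x₂ := mul_le_mul_of_nonneg_left hx2 hq
    linarith
  · have : q * x ≤ q * x₁ := mul_le_mul_of_nonpos_left hx1 hq
    linarith

/-- **Cell bound.**  `A, B ≥ 0`, `0 ≤ κ ≤ 1`, menu points `x₀, s₀ > 0` with heights `x₀^κ ≤ ρ`, `s₀^κ ≤ σ`;
if the linear majorant `A((1−κ)ρ + κ(ρ/x₀)x) + B((1−κ)σ + κ(σ/s₀)(1−x))` is `≤ R` at both ends of the cell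
`[x₁, x₂] ⊆ [0, 1]`, then `A x^κ + B(1−x)^κ ≤ R` on the cell. -/
theorem cell_bound {A B κ x₀ s₀ ρ σ R x₁ x₂ : ℝ} (hA : 0 ≤ A) (hB : 0 ≤ B) (hκ0 : 0 ≤ κ) (hκ1 : κ ≤ 1)
    (hx0 : 0 < x₀) (hs0 : 0 < s₀) (hρ : x₀ ^ κ ≤ ρ) (hσ : s₀ ^ κ ≤ σ) (hx₁ : 0 ≤ x₁) (hx₂ : x₂ ≤ 1)
    (h1 : A * ((1 - κ) * ρ + κ * (ρ / x₀) * x₁) + B * ((1 - κ) * σ + κ * (σ / s₀) * (1 - x₁)) ≤ R)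
    (h2 : A * ((1 - κ) * ρ + κ * (ρ / x₀) * x₂) + B * ((1 - κ) * σ + κ * (σ / s₀) * (1 - x₂)) ≤ R) :
    ∀ x : ℝ, x₁ ≤ x → x ≤ x₂ → A * x ^ κ + B * (1 - x) ^ κ ≤ R := by
  intro x hx1 hx2
  have hx : 0 ≤ x := le_trans hx₁ hx1
  have hx' : 0 ≤ 1 - x := by linarith
  have ha := mul_le_mul_of_nonneg_left (tangent_height hx hx0 hκ0 hκ1 hρ) hA
  have hb := mul_le_mul_of_nonneg_left (tangent_height hx' hs0 hκ0 hκ1 hσ) hB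
  -- the majorant is linear in x: p + q x
  have e : ∀ y : ℝ, A * ((1 - κ) * ρ + κ * (ρ / x₀) * y) + B * ((1 - κ) * σ + κ * (σ / s₀) * (1 - y)) =
      (A * ((1 - κ) * ρ) + B * ((1 - κ) * σ + κ * (σ / s₀))) +
        (A * (κ * (ρ / x₀)) - B * (κ * (σ / s₀))) * y := by intro y; ring
  rw [e] at h1 h2
  have hl := lin_cell h1 h2 hx1 hx2
  rw [← e] at hl
  linarith

/-- **Strip bound with a certified height.**  As `strip_bound` (XLII-E) but with a rational `σ ≥ s₀^κ`:
`B·σ ≤ A·s₀` and `(1−κ)·B·σ ≤ m` suffice. -/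
theorem strip_bound_height {A B κ s₀ σ m : ℝ} (hA : 0 ≤ A) (hB : 0 ≤ B) (hκ0 : 0 ≤ κ) (hκ1 : κ ≤ 1)
    (hs0 : 0 < s₀) (hσ : s₀ ^ κ ≤ σ) (hdom : B * σ ≤ A * s₀) (hm : (1 - κ) * B * σ ≤ m) :
    ∀ x : ℝ, 0 ≤ x → x ≤ 1 → A * x ^ κ + B * (1 - x) ^ κ ≤ A + m := by
  have hpow : 0 < s₀ ^ κ := rpow_pos_of_pos hs0 κ
  have hσ0 : 0 < σ := lt_of_lt_of_le hpow hσ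
  -- B ≤ A s₀^{1−κ}
  have hdom' : B ≤ A * s₀ ^ (1 - κ) := by
    have e : s₀ ^ (1 - κ) = s₀ / s₀ ^ κ := by
      rw [rpow_sub hs0, rpow_one]
    rw [e]
    have h1 : B ≤ A * s₀ / σ := by rw [le_div_iff₀ hσ0]; linarith
    have h2 : A * s₀ / σ ≤ A * s₀ / s₀ ^ κ :=
      div_le_div_of_nonneg_left (mul_nonneg hA hs0.le) hpow hσ
    calc B ≤ A * s₀ / σ := h1
      _ ≤ A * s₀ / s₀ ^ κ := h2
      _ = A * (s₀ / s₀ ^ κ) := by ring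
  have hm' : (1 - κ) * B * s₀ ^ κ ≤ m :=
    le_trans (mul_le_mul_of_nonneg_left hσ (mul_nonneg (by linarith) hB)) hm
  exact strip_bound hA hB hκ0 hκ1 hs0 hdom' hm'

/-- **The criterion's pair inequality on the strip, with a certified height** (cf. XLII-E
`criterion_pair_of_strip`): `σ ≥ s₀^κ`, `B·σ ≤ A·s₀`, `(1−κ)·B·σ ≤ λ'·c`. -/
theorem criterion_pair_of_strip_height {β z ε κ lam lam' V V' VP s₀ σ : ℝ} (hκ0 : 0 ≤ κ) (hκ1 : κ ≤ 1)
    (hA : 0 ≤ (1 - (β - 1) * lam') * (lam * (ε + 1 - V)))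
    (hB : 0 ≤ (1 - (β - 1) * lam) * (lam' * (ε + 1 - V')))
    (hP : VP * (lam + lam' - (2 * β - 1) * lam * lam') =
      lam' * (1 - β * lam) * V' + lam * (1 - β * lam') * V + z * lam * lam' * V * V')
    (hs0 : 0 < s₀) (hσ : s₀ ^ κ ≤ σ)
    (hdom : (1 - (β - 1) * lam) * (lam' * (ε + 1 - V')) * σ ≤
      (1 - (β - 1) * lam') * (lam * (ε + 1 - V)) * s₀)
    (hm : (1 - κ) * ((1 - (β - 1) * lam) * (lam' * (ε + 1 - V'))) * σ ≤
      lam' * ((1 - β * lam) * (ε + 1 - V') + lam * V * (1 - z * V'))) :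
    ∀ x : ℝ, 0 ≤ x → x ≤ 1 →
      (1 - (β - 1) * lam') * (lam * (ε + 1 - V)) * x ^ κ +
          (1 - (β - 1) * lam) * (lam' * (ε + 1 - V')) * (1 - x) ^ κ ≤
        (lam + lam' - (2 * β - 1) * lam * lam') * (ε + 1 - VP) := by
  intro x hx0 hx1
  have h := strip_bound_height hA hB hκ0 hκ1 hs0 hσ hdom hm x hx0 hx1
  have hid := neutral_identity (ε := ε) hP
  linarith

end Summit.MatrixMultiplication.MatrixMultiplication.Theorems.FarEdgeDescentCriterionCells
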